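import Summits.HodgeConjecture.HodgeConjecture.Theorems.MarkmanPartnerTransportPicardThreeK3SquaresQuotientSimilitudeSectors
import Summits.HodgeConjecture.HodgeConjecture.Theorems.MarkmanPartnerTransportPicardThreeK3SquaresKugaSatakeSectorU2ab

/-!
# Route MarkmanPartnerTransport · crux `PicardThreeK3Squares` (stmt-HodgeConjecture-19652) —
# the named fact `Varesco2023_sqrtThree_algebraic_of_transcendental_embedding` DERIVED from Varesco's
# quotient similitude of order `3`, Buskin's theorem and the existence of markings

The record `Varesco2023_sqrtThree_algebraic_of_transcendental_embedding` (Varesco 2023 Thm. 2.1 for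
`p = 3` ∘ Prop. 2.11, the printed CONCLUSION; file `K3SqrtThreeOfTranscendentalEmbedding`) is implied
in the kernel by `Varesco2023_quotientSimilitude_three_of_transcendental_embedding` (the intermediate
object of its proof), `Buskin2019_hodgeIsometry_algebraic` and `Huybrechts_K3_marking_exists` — through
gen 5's `QuotientSimilitude.sqrtThree_cycleInduced_of_embedding` (Varesco's proof in the tree). Three
pieces of glue, all marking bookkeeping:

* `generator_eq_of_latticeMarkings` — two LATTICE markings `(η, p)`, `(η', p')` of the same smooth
  projective surface (integral classes `↔ ℤ²²`, cup product `=` K3 form `• p`) have `p' = p`: `p' = ±p`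
  as both generate `H⁴(S(ℂ); ℤ)`, and `p' = −p` would make `η' ∘ η⁻¹` an anti-isometry of `Λ_ℚ`,
  carrying the four pairwise orthogonal vectors `e_k − f_k ∈ U_k` (`k = 1,2,3`), `α₁ − α₁' ∈ E₈(−1)²` of
  negative square to four pairwise orthogonal vectors of POSITIVE square — impossible in signature `(3,19)`
  (`KugaSatakeSector.not_four_orthogonal_pos`).
* `exists_period_of_latticeMarking` — every lattice marking `(η, p)` of a projective K3 surface extends
  to a full marking `(η, p, x)` (period clauses of `Huybrechts_K3_marking_exists`): transport the period
  `x'` of any full marking `(η', p', x')` by `x = η(η'⁻¹ x')` (`p' = p`; conjugation commutes with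
  integral markings, `conjClass_marking_symm`).
* `isAlgebraicCorrespondence_of_corr` — the `Corr[μ ; γ, –]` spelling implies the tree's
  `IsAlgebraicCorrespondence 2 2 S S` (converse of `SymplecticLocus.exists_corr_of_isAlgebraicCorrespondence`).

* `varesco2023_sqrtThree_of_quotientSimilitude` — **the named fact, from the three inputs.**
* `hodgeConjectureFor_square_of_sqrtTwoSector_of_embedding` / `…sqrtThreeSector_of_embedding` — HC⁴(S ⊗ S)
  in the `√2`- / `√3`-sector under the lattice criterion at ANY Picard rank (e.g. `ρ ∈ {9, 10}` resp.
  `{13, 14}`), mod {Buskin, quotient_p}.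

No definition, no sorry. Prover seat hodge-nonav-19652-p1 (gen 5), `--supports stmt-HodgeConjecture-19652`.

References: M. Varesco, Math. Z. 305 (2023) §2, Thm. 2.1 and Prop. 2.11; D. Huybrechts, *Lectures on
K3 surfaces*, Ch. 1 Prop. 3.5, Ch. 14 §0.3 (vi); N. Buskin, J. reine angew. Math. 755 (2019).
-/

set_option linter.dupNamespace false

noncomputable section

namespace Summit.HodgeConjecture.HodgeConjecture.Theorems.MarkmanPartnerTransport.QuotientSimilitude

open scoped Manifold
open Module CategoryTheory MonoidalCategory CartesianMonoidalCategory
open Literature.AlgebraicGeometry Literature.AlgebraicGeometry.Motives Literature.AlgebraicGeometry.HodgeTheory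
open Literature.AlgebraicGeometry.Surfaces
open Literature.AlgebraicTopology.SingularHomology
open Summit.HodgeConjecture.HodgeConjecture.Theorems
open Summit.HodgeConjecture.HodgeConjecture.Theorems.NikulinTwinTransport
open Summit.HodgeConjecture.HodgeConjecture.Theorems.NikulinTwinTransport.SquareGlueFree
open Summit.HodgeConjecture.HodgeConjecture.Theorems.MarkmanPartnerTransport

variable {S : SchemeOver ℂ}

/-- `MarkedK3[S, η, p, x]`: VERBATIM the `let MarkedK3 := …` binder of the route declaration
`PicardThreeK3Squares`. Local notation only. -/
local notation3 (prettyPrint := false) "MarkedK3[" S ", " η ", " p ", " x "]" =>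
  (p ≠ 0 ∧ (IsIntegralClass p ∧
    (∀ q : complexBetti S (2 * 2), IsIntegralClass q → ∃ n : ℤ, q = n • p) ∧
    (∀ c : complexBetti S (2 * 1), IsIntegralClass c ↔ ∃ v : K3Index → ℤ, η c = fun i => (v i : ℂ)) ∧
    (∀ a b : complexBetti S (2 * 1),
      cupProduct (rfl : 2 * 1 + 2 * 1 = 2 * 2) a b = k3Form (η a) (η b) • p) ∧
    IsOfHodgeType 2 S (2 * 1) 2 0 (LinearEquiv.symm η x) ∧
    (∀ τ : complexBetti S (2 * 1), IsOfHodgeType 2 S (2 * 1) 2 0 τ →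
      ∃ t : ℂ, τ = t • LinearEquiv.symm η x)) ∧
    (k3Form x x = 0 ∧ 0 < (k3Form (star x) x).re ∧
      ∃ u : K3Index → ℤ, k3Form (fun i => (u i : ℂ)) x = 0 ∧ 0 < ∑ i, ∑ j, u i * k3Gram i j * u j))

/-- `Corr[μ, X, Y, hX, hY ; γ, y] = fst_* (snd^* y ∪ γ)` (`hX hY : IsSmoothProjective 2 _`). Local notation only. -/
local notation3 (prettyPrint := false) "Corr[" μ ", " X ", " Y ", " hX ", " hY " ; " γ ", " y "]" =>
  complexGysin μ (IsSmoothProjective.tensor_holds hX hY) hX (SemiCartesianMonoidalCategory.fst X Y)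
    (rfl : 2 * 1 + 2 * 2 + 2 * 2 = 2 * 1 + 2 * (2 + 2))
    (cupProduct (rfl : 2 * 1 + 2 * 2 = 2 * 1 + 2 * 2)
      (complexBetti.map (SemiCartesianMonoidalCategory.snd X Y) (2 * 1) y) γ)

/-- `SqrtSector[S, ψ, q]`: the `√q`-sector data, VERBATIM as in `…SqrtNatSector`. Local notation only. -/
local notation3 (prettyPrint := false) "SqrtSector[" S ", " ψ ", " q "]" =>
  (Set.MapsTo ψ (transcendentalSubspace S) (transcendentalSubspace S) ∧
    (∀ x ∈ transcendentalSubspace S, IsRationalClass x → IsRationalClass (ψ x)) ∧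
    (∀ (i j : ℕ), ∀ x ∈ transcendentalSubspace S,
      IsOfHodgeType 2 S (2 * 1) i j x → IsOfHodgeType 2 S (2 * 1) i j (ψ x)) ∧
    (∀ x ∈ transcendentalSubspace S, ψ (ψ x) = ((q : ℕ) : ℂ) • x) ∧
    (∀ x ∈ transcendentalSubspace S, ∀ y ∈ transcendentalSubspace S,
      cupProduct (rfl : 2 * 1 + 2 * 1 = 2 * 2) (ψ x) (ψ y) =
        ((q : ℕ) : ℂ) • cupProduct (rfl : 2 * 1 + 2 * 1 = 2 * 2) x y) ∧
    (∀ (f : complexBetti S (2 * 1) →ₗ[ℂ] complexBetti S (2 * 1)),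
      (∀ y, IsRationalClass y → IsRationalClass (f y)) →
      (∀ (i j : ℕ) y, IsOfHodgeType 2 S (2 * 1) i j y → IsOfHodgeType 2 S (2 * 1) i j (f y)) →
      (∀ d ∈ algebraicClasses S 1, f d = 0) →
      (∀ y : complexBetti S (2 * 1), ∀ d ∈ algebraicClasses S 1,
        cupProduct (rfl : 2 * 1 + 2 * 1 = 2 * 2) (f y) d = 0) →
      ∃ a b : ℚ, ∀ y : complexBetti S (2 * 1),
        (∀ d ∈ algebraicClasses S 1, cupProduct (rfl : 2 * 1 + 2 * 1 = 2 * 2) y d = 0) →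
        f y = (a : ℂ) • y + (b : ℂ) • ψ y))

/-! ### Bridge: the `Corr` spelling gives `IsAlgebraicCorrespondence` -/

/-- **`[γ]_* = pr₁_*(pr₂^*(–) ∪ γ)` for an algebraic `γ` (any orientation family `μ`) is an algebraic
correspondence in the tree's sense** (`IsAlgebraicCorrespondence 2 2 S S`: `corrClassAction` for the
orientations `μ (S ⊗ S)`, `μ S`, which satisfy Poincaré duality, `OrientationFamily.hasPoincareDuality`;
`complexGysin` IS that Gysin map, `complexGysin_eq_gysinMap`).
[cite: VoisinHodgeII2003, proof of Thm. 10.17 (10.7)] [cite: FultonYoungTableaux1997, Appendix B §B.1 (5)] -/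
theorem isAlgebraicCorrespondence_of_corr (μ : OrientationFamily) (hS : IsSmoothProjective 2 S)
    {γ : complexBetti (S ⊗ S) (2 * 2)} (hγ : γ ∈ algebraicClasses (S ⊗ S) 2)
    {T : complexBetti S (2 * 1) →ₗ[ℂ] complexBetti S (2 * 1)} (hT : ∀ y, T y = Corr[μ, S, S, hS, hS ; γ, y]) :
    IsAlgebraicCorrespondence 2 2 S S T := by
  have hSS : IsSmoothProjective (2 + 2) (S ⊗ S) := IsSmoothProjective.tensor_holds hS hS
  refine ⟨μ hSS, μ hS, OrientationFamily.hasPoincareDuality μ hSS, OrientationFamily.hasPoincareDuality μ hS,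
    2, 2, rfl, (by omega : 2 * 1 + 2 = 2 * 2), γ, hγ, ?_⟩
  ext y
  rw [corrClassAction_apply, hT y,
    complexGysin_eq_gysinMap hSS hS (fst S S) (rfl : 2 * 1 + 2 * 2 + 2 * 2 = 2 * 1 + 2 * (2 + 2))
      (show 2 * 1 + 2 * 2 + 2 = 2 * (2 + 2) by omega) (by omega : 2 * 1 + 2 = 2 * 2)]

/-! ### Two lattice markings of one surface have the same generator `p` -/

/-- Off-diagonal blocks of the K3 Gram matrix vanish: `E₈(−1)² ⟂ U³`. [cite: Huybrechts2016K3, Ch. 1 §3.3] -/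
theorem k3Gram_inl_inr (a : Fin 8 ⊕ Fin 8) (b : Fin 2 ⊕ (Fin 2 ⊕ Fin 2)) :
    k3Gram (Sum.inl a) (Sum.inr b) = 0 := by
  simp [k3Gram]

/-- … the first hyperbolic plane is orthogonal to the other two. [cite: Huybrechts2016K3, Ch. 1 §3.3] -/
theorem k3Gram_inr_inl_inr_inr (i : Fin 2) (c : Fin 2 ⊕ Fin 2) :
    k3Gram (Sum.inr (Sum.inl i)) (Sum.inr (Sum.inr c)) = 0 := by
  simp [k3Gram]

/-- … and the second hyperbolic plane is orthogonal to the third. [cite: Huybrechts2016K3, Ch. 1 §3.3] -/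
theorem k3Gram_inr_inr_inl_inr_inr_inr (i j : Fin 2) :
    k3Gram (Sum.inr (Sum.inr (Sum.inl i))) (Sum.inr (Sum.inr (Sum.inr j))) = 0 := by
  simp [k3Gram]

/-- `k3FormRat` on basis vectors is the Gram entry. [folklore] -/
theorem k3FormRat_single_single (i j : K3Index) :
    k3FormRat (Pi.single i 1) (Pi.single j 1) = (k3Gram i j : ℚ) := by
  rw [k3FormRat, Matrix.toBilin'_single, Matrix.map_apply]

/-- First indices of the four test vectors `e_k − f_k ∈ U_k` (`k = 1,2,3`), `α₁ − α₁' ∈ E₈(−1)²`. -/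
private def tvFst : Fin 4 → K3Index :=
  ![Sum.inr (Sum.inl 0), Sum.inr (Sum.inr (Sum.inl 0)), Sum.inr (Sum.inr (Sum.inr 0)), Sum.inl (Sum.inl 0)]

/-- Second indices of the four test vectors. -/
private def tvSnd : Fin 4 → K3Index :=
  ![Sum.inr (Sum.inl 1), Sum.inr (Sum.inr (Sum.inl 1)), Sum.inr (Sum.inr (Sum.inr 1)), Sum.inl (Sum.inr 0)]

/-- The integral test vectors `δ_{tvFst k} − δ_{tvSnd k}`. -/
private def testVec (k : Fin 4) : K3Index → ℤ := Pi.single (tvFst k) 1 - Pi.single (tvSnd k) 1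

/-- The rational test vectors. -/
private def testVecQ (k : Fin 4) : K3Index → ℚ := Pi.single (tvFst k) 1 - Pi.single (tvSnd k) 1

/-- The rational test vectors are the casts of the integral ones. -/
private theorem testVecQ_eq (k : Fin 4) : (fun i => (testVec k i : ℚ)) = testVecQ k := by
  funext i
  have h : ∀ a : K3Index, ((Pi.single a (1 : ℤ) : K3Index → ℤ) i : ℚ) = (Pi.single a (1 : ℚ) : K3Index → ℚ) i :=
    fun a => by
      rw [Pi.apply_single (fun _ => (Int.cast : ℤ → ℚ)) (fun _ => Int.cast_zero) a 1 i, Int.cast_one]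
  simp only [testVec, testVecQ, Pi.sub_apply, Int.cast_sub, h]

/-- The Gram entries between the indices of two different test vectors vanish (different blocks). [cite: Huybrechts2016K3, Ch. 1 §3.3] -/
private theorem k3Gram_tv_of_ne (k l : Fin 4) (hkl : k ≠ l) :
    k3Gram (tvFst k) (tvFst l) = 0 ∧ k3Gram (tvFst k) (tvSnd l) = 0 ∧
      k3Gram (tvSnd k) (tvFst l) = 0 ∧ k3Gram (tvSnd k) (tvSnd l) = 0 := by
  fin_cases k <;> fin_cases l <;> first | exact absurd rfl hkl | simp [tvFst, tvSnd, k3Gram]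

/-- The test vectors are pairwise orthogonal. [cite: Huybrechts2016K3, Ch. 1 §3.3] -/
private theorem k3FormRat_testVecQ_of_ne (k l : Fin 4) (hkl : k ≠ l) :
    k3FormRat (testVecQ k) (testVecQ l) = 0 := by
  obtain ⟨h1, h2, h3, h4⟩ := k3Gram_tv_of_ne k l hkl
  simp only [testVecQ, map_sub, LinearMap.sub_apply, k3FormRat_single_single, h1, h2, h3, h4, Int.cast_zero,
    sub_zero]

/-- The test vectors have negative square (they lie in the antidiagonal `19`-space). [cite: Huybrechts2016K3, Ch. 14 §0.3 (vi)] -/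
private theorem k3FormRat_testVecQ_self_neg (k : Fin 4) : k3FormRat (testVecQ k) (testVecQ k) < 0 := by
  refine KugaSatakeSector.k3FormRat_self_neg_of_antidiag ?_ ?_ ?_ ?_
  · fin_cases k <;> simp [testVecQ, tvFst, tvSnd]
  · fin_cases k <;> simp [testVecQ, tvFst, tvSnd]
  · fin_cases k <;> simp [testVecQ, tvFst, tvSnd]
  · intro h
    have h1 := congrFun h (tvFst k)
    have hne : tvFst k ≠ tvSnd k := by fin_cases k <;> simp [tvFst, tvSnd]
    simp only [testVecQ, Pi.sub_apply, Pi.single_eq_same, Pi.single_eq_of_ne hne, sub_zero, Pi.zero_apply,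
      one_ne_zero] at h1

/-- **Two lattice markings of the same surface have the same generator.** For a smooth projective
surface `S` and two pairs `(η, p)`, `(η', p')` — `p`, `p'` integral generators of the integral classes of
`H⁴(S(ℂ); ℂ)`, `η`, `η'` identifying integral classes with `ℤ²²` and the cup product with the K3 form
`• p` resp. `• p'` — one has `p' = p`. Proof in the module docstring (`p' = ±p`; the sign `−` would
give four pairwise orthogonal positive vectors in `Λ_ℚ`, of signature `(3, 19)`).
[cite: Huybrechts2016K3, Ch. 1 Prop. 3.5 and Ch. 14 §0.3 (vi)] -/
theorem generator_eq_of_latticeMarkings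
    (η : complexBetti S (2 * 1) ≃ₗ[ℂ] (K3Index → ℂ)) (p : complexBetti S (2 * 2)) (hp₀ : p ≠ 0)
    (hpint : IsIntegralClass p)
    (hpgen : ∀ q : complexBetti S (2 * 2), IsIntegralClass q → ∃ n : ℤ, q = n • p)
    (hηint : ∀ c : complexBetti S (2 * 1), IsIntegralClass c ↔ ∃ v : K3Index → ℤ, η c = fun i => (v i : ℂ))
    (hηcup : ∀ a b : complexBetti S (2 * 1),
      cupProduct (rfl : 2 * 1 + 2 * 1 = 2 * 2) a b = k3Form (η a) (η b) • p)
    (η' : complexBetti S (2 * 1) ≃ₗ[ℂ] (K3Index → ℂ)) (p' : complexBetti S (2 * 2))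
    (hp'int : IsIntegralClass p')
    (hp'gen : ∀ q : complexBetti S (2 * 2), IsIntegralClass q → ∃ n : ℤ, q = n • p')
    (hη'int : ∀ c : complexBetti S (2 * 1), IsIntegralClass c ↔ ∃ v : K3Index → ℤ, η' c = fun i => (v i : ℂ))
    (hη'cup : ∀ a b : complexBetti S (2 * 1),
      cupProduct (rfl : 2 * 1 + 2 * 1 = 2 * 2) a b = k3Form (η' a) (η' b) • p') :
    p' = p := by
  classical
  have hsmul0 : ∀ {c : ℂ}, c • p = 0 → c = 0 := fun h => by
    rcases smul_eq_zero.1 h with h | h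
    · exact h
    · exact absurd h hp₀
  obtain ⟨n, hn⟩ := hpgen p' hp'int
  obtain ⟨n', hn'⟩ := hp'gen p hpint
  have hn1 : n' * n = 1 := by
    have h : (((n' * n : ℤ) : ℂ) - 1) • p = 0 := by
      rw [sub_smul, one_smul, Int.cast_mul, mul_smul, Int.cast_smul_eq_zsmul, Int.cast_smul_eq_zsmul, ← hn,
        ← hn', sub_self]
    exact_mod_cast sub_eq_zero.1 (hsmul0 h)
  rcases Int.eq_one_or_neg_one_of_mul_eq_one' hn1 with ⟨-, rfl⟩ | ⟨-, rfl⟩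
  · rw [hn, one_smul]
  · -- `p' = -p`: `η' ∘ η⁻¹` is an anti-isometry — contradiction with signature `(3, 19)`
    exfalso
    rw [neg_one_zsmul] at hn
    have hneg : ∀ a b : complexBetti S (2 * 1), k3Form (η' a) (η' b) = -k3Form (η a) (η b) := by
      intro a b
      have h := hηcup a b
      rw [hη'cup, hn, smul_neg, ← neg_smul] at h
      have h2 : (k3Form (η' a) (η' b) + k3Form (η a) (η b)) • p = 0 := by
        rw [add_smul, ← h, ← add_smul, add_neg_cancel, zero_smul]
      exact eq_neg_of_add_eq_zero_left (hsmul0 h2)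
    -- the classes `a_k = η⁻¹(v_k)` and their integral `η'`-coordinates `w_k`
    have hw : ∀ k : Fin 4, ∃ w : K3Index → ℤ,
        η' (η.symm fun i => (testVec k i : ℂ)) = fun i => (w i : ℂ) := fun k =>
      (hη'int _).1 ((hηint _).2 ⟨testVec k, η.apply_symm_apply _⟩)
    choose w hw using hw
    refine KugaSatakeSector.not_four_orthogonal_pos (fun k i => (w k i : ℚ)) (fun k => ?_) (fun k l hkl => ?_)
    · have h := hneg (η.symm fun i => (testVec k i : ℂ)) (η.symm fun i => (testVec k i : ℂ))
      rw [hw, η.apply_symm_apply, intCast_eq_ratCast_intCast, intCast_eq_ratCast_intCast (testVec k),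
        k3Form_ratCast, k3Form_ratCast, ← Rat.cast_neg, Rat.cast_inj, testVecQ_eq] at h
      rw [h]
      exact neg_pos.2 (k3FormRat_testVecQ_self_neg k)
    · have h := hneg (η.symm fun i => (testVec k i : ℂ)) (η.symm fun i => (testVec l i : ℂ))
      rw [hw, hw, η.apply_symm_apply, η.apply_symm_apply, intCast_eq_ratCast_intCast,
        intCast_eq_ratCast_intCast (w l), intCast_eq_ratCast_intCast (testVec k),
        intCast_eq_ratCast_intCast (testVec l), k3Form_ratCast, k3Form_ratCast, ← Rat.cast_neg, Rat.cast_inj,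
        testVecQ_eq, testVecQ_eq, k3FormRat_testVecQ_of_ne k l hkl, neg_zero] at h
      exact h

/-! ### Every lattice marking extends to a full marking -/

/-- **Every lattice marking `(η, p)` of a projective K3 surface extends to a full marking `(η, p, x)`**
(the period clauses: `η⁻¹x` of type `(2,0)` spanning the `(2,0)`-classes, `(x.x) = 0`, `(x̄.x) > 0`,
an integral `u ⟂ x` of positive square), granted `Huybrechts_K3_marking_exists`: take any full marking
`(η', p', x')`; then `p' = p` (`generator_eq_of_latticeMarkings`) and `x = η(η'⁻¹x')` works, with
`u = η(η'⁻¹u')` (conjugation commutes with integral markings, `conjClass_marking_symm`).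
[cite: Huybrechts2016K3, Ch. 1 Prop. 3.5; Ch. 6 Prop. 1.2; Ch. 1 §3] -/
theorem exists_period_of_latticeMarking (hmark : Huybrechts_K3_marking_exists) (hS : IsK3Surface S)
    (η : complexBetti S (2 * 1) ≃ₗ[ℂ] (K3Index → ℂ)) (p : complexBetti S (2 * 2)) (hp₀ : p ≠ 0)
    (hpint : IsIntegralClass p)
    (hpgen : ∀ q : complexBetti S (2 * 2), IsIntegralClass q → ∃ n : ℤ, q = n • p)
    (hηint : ∀ c : complexBetti S (2 * 1), IsIntegralClass c ↔ ∃ v : K3Index → ℤ, η c = fun i => (v i : ℂ))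
    (hηcup : ∀ a b : complexBetti S (2 * 1),
      cupProduct (rfl : 2 * 1 + 2 * 1 = 2 * 2) a b = k3Form (η a) (η b) • p) :
    ∃ x : K3Index → ℂ, MarkedK3[S, η, p, x] := by
  classical
  obtain ⟨η', p', x', hp'0, ⟨hp'int, hp'gen, hη'int, hη'cup, hx'20, hx'line⟩, hx'x', hx'pos, u', hu'x', hu'pos⟩ :=
    hmark S hS
  have hpp : p' = p :=
    generator_eq_of_latticeMarkings η p hp₀ hpint hpgen hηint hηcup η' p' hp'int hp'gen hη'int hη'cup
  subst hpp
  have hsmul0 : ∀ {c : ℂ}, c • p' = 0 → c = 0 := fun h => by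
    rcases smul_eq_zero.1 h with h | h
    · exact h
    · exact absurd h hp₀
  -- cup products agree in the two markings
  have hcoord : ∀ a b : complexBetti S (2 * 1), k3Form (η a) (η b) = k3Form (η' a) (η' b) := by
    intro a b
    have h := hηcup a b
    rw [hη'cup] at h
    have h2 : (k3Form (η a) (η b) - k3Form (η' a) (η' b)) • p' = 0 := by rw [sub_smul, ← h, sub_self]
    exact sub_eq_zero.1 (hsmul0 h2)
  set σ := η'.symm x' with hσdef
  set x : K3Index → ℂ := η σ with hxdef
  have hσx : η.symm x = σ := by rw [hxdef, η.symm_apply_apply]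
  have hη'σ : η' σ = x' := by rw [hσdef, η'.apply_symm_apply]
  -- conjugation: `η⁻¹ x̄ = σ̄ = η'⁻¹ x̄'`
  have hbar : η.symm (star x) = η'.symm (star x') := by
    rw [← conjClass_marking_symm η hηint x, hσx, hσdef, conjClass_marking_symm η' hη'int x']
  -- the integral class `u = η(η'⁻¹ u')`
  obtain ⟨u, hu⟩ : ∃ u : K3Index → ℤ, η (η'.symm fun i => (u' i : ℂ)) = fun i => (u i : ℂ) :=
    (hηint _).1 ((hη'int _).2 ⟨u', η'.apply_symm_apply _⟩)
  refine ⟨x, hp₀, ⟨hpint, hpgen, hηint, hηcup, by rw [hσx]; exact hx'20, fun τ hτ => ?_⟩, ?_, ?_, u, ?_, ?_⟩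
  · obtain ⟨t, ht⟩ := hx'line τ hτ
    exact ⟨t, by rw [hσx, ht]⟩
  · have h := hcoord σ σ
    rw [← hxdef, hη'σ, hx'x'] at h
    exact h
  · have h := hcoord (η.symm (star x)) σ
    rw [η.apply_symm_apply, ← hxdef, hbar, η'.apply_symm_apply, hη'σ] at h
    rw [h]
    exact hx'pos
  · have h := hcoord (η'.symm fun i => (u' i : ℂ)) σ
    rw [hu, ← hxdef, η'.apply_symm_apply, hη'σ, hu'x'] at h
    exact h
  · have h := hcoord (η'.symm fun i => (u' i : ℂ)) (η'.symm fun i => (u' i : ℂ))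
    rw [hu, η'.apply_symm_apply, k3Form_intCast, k3Form_intCast, Int.cast_inj] at h
    rw [h]
    exact hu'pos

/-! ### The named fact, derived -/

/-- **`Varesco2023_sqrtThree_algebraic_of_transcendental_embedding` follows from
`Varesco2023_quotientSimilitude_three_of_transcendental_embedding`, `Buskin2019_hodgeIsometry_algebraic` and
`Huybrechts_K3_marking_exists`.** Complete the lattice marking (`exists_period_of_latticeMarking`), obtain
the cycle from `sqrtThree_cycleInduced_of_embedding` (Varesco's proof: `3⁻¹ψφ` is a rational Hodge
isometry, algebraic by Buskin; compose with `ᵗφ`), and read `[γ]_*` as an `IsAlgebraicCorrespondence`.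
[cite: Varesco2023, §2, Thm. 2.1 (proof) and Prop. 2.11] [cite: Buskin2019, Thm. 1.1] -/
theorem varesco2023_sqrtThree_of_quotientSimilitude
    (hQ3 : Varesco2023_quotientSimilitude_three_of_transcendental_embedding)
    (hB : Buskin2019_hodgeIsometry_algebraic) (hmark : Huybrechts_K3_marking_exists) :
    Varesco2023_sqrtThree_algebraic_of_transcendental_embedding := by
  intro S hS η p hp₀ hpint hpgen hηint hηcup ι hiso hinj ψ hψT hψrat hψtyp hψsq hψmul
  obtain ⟨x, hM⟩ := exists_period_of_latticeMarking hmark hS η p hp₀ hpint hpgen hηint hηcup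
  obtain ⟨γ, hγalg, hγ⟩ := sqrtThree_cycleInduced_of_embedding hB hQ3 hS η p x hM ι hiso hinj ψ hψT hψrat
    hψtyp hψsq hψmul
  refine ⟨(complexGysin complexOrientationFamily (IsSmoothProjective.tensor_holds hS.1 hS.1) hS.1
        (SemiCartesianMonoidalCategory.fst S S) (rfl : 2 * 1 + 2 * 2 + 2 * 2 = 2 * 1 + 2 * (2 + 2))) ∘ₗ
      ((cupProduct (rfl : 2 * 1 + 2 * 2 = 2 * 1 + 2 * 2)).flip γ) ∘ₗ
      (complexBetti.map (SemiCartesianMonoidalCategory.snd S S) (2 * 1)).hom,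
    isAlgebraicCorrespondence_of_corr complexOrientationFamily hS.1 hγalg (fun _ => rfl), fun z hz => ?_⟩
  exact hγ z hz

/-! ### The `√2`- / `√3`-sector at ANY Picard rank under the lattice criteria -/

/-- **HC⁴(S ⊗ S) for every marked projective K3 surface in the `√2`-sector with
`T(S)_ℚ ↪ (U³ ⊕ E₈(−2)) ⊗ ℚ`, at ANY Picard rank** (e.g. `ρ(S) ∈ {9, 10}`: K3 surfaces Hodge isometric to
one with a Nikulin involution, Varesco Prop. 2.5, with `End_Hdg(T(S)) = ℚ(√2)`), modulo
`Buskin2019_hodgeIsometry_algebraic` and `Varesco2023_quotientSimilitude_two_of_transcendental_embedding` —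
the isogeny saturation of gen 0's `SymplecticLocus.hodgeConjectureFor_square_of_isNikulinInvolution`, by
name. [cite: Varesco2023, Thm. 2.1, Prop. 2.5 and Thm. 2.9] [cite: Buskin2019, Thm. 1.1] -/
theorem hodgeConjectureFor_square_of_sqrtTwoSector_of_embedding (hB : Buskin2019_hodgeIsometry_algebraic)
    (hQ2 : Varesco2023_quotientSimilitude_two_of_transcendental_embedding) (hS : IsK3Surface S)
    (η : complexBetti S (2 * 1) ≃ₗ[ℂ] (K3Index → ℂ)) (p : complexBetti S (2 * 2)) (x : K3Index → ℂ)
    (hM : MarkedK3[S, η, p, x])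
    (ι : (K3Index → ℚ) →ₗ[ℚ] (Fin 14 → ℚ))
    (hiso : ∀ v w : K3Index → ℚ, IsTranscendentalCoord S η v → IsTranscendentalCoord S η w →
      ∑ i : Fin 14, (![1, 1, 1, -1, -1, -1, -1, -1, -1, -1, -1, -1, -1, -1] : Fin 14 → ℚ) i * ι v i * ι w i =
        k3FormRat v w)
    (hinj : ∀ v : K3Index → ℚ, IsTranscendentalCoord S η v → ι v = 0 → v = 0)
    (ψ : complexBetti S (2 * 1) →ₗ[ℂ] complexBetti S (2 * 1)) (hψ : SqrtSector[S, ψ, 2]) :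
    HodgeConjectureFor 4 (S ⊗ S) := by
  obtain ⟨hψT, hψrat, hψtyp, hψsq, hψmul, -⟩ := id hψ
  obtain ⟨γ, hγalg, hγ⟩ := sqrtTwo_cycleInduced_of_embedding hB hQ2 hS η p x hM ι hiso hinj ψ hψT hψrat hψtyp
    (fun y hy ↦ by simpa using hψsq y hy) (fun y hy z hz ↦ by simpa using hψmul y hy z hz)
  exact hodgeConjectureFor_square_of_corr_of_sector hS ψ hψ hγalg hγ

/-- **HC⁴(S ⊗ S) for every marked projective K3 surface in the `√3`-sector with
`T(S)_ℚ ↪ (U³ ⊕ A₂²) ⊗ ℚ`, at ANY Picard rank** (e.g. `ρ(S) ∈ {13, 14}`, Varesco Prop. 2.11, with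
`End_Hdg(T(S)) = ℚ(√3)`), modulo `Buskin2019_hodgeIsometry_algebraic` and
`Varesco2023_quotientSimilitude_three_of_transcendental_embedding`. [cite: Varesco2023, Thm. 2.1, Prop. 2.11 and Thm. 2.15]
[cite: Buskin2019, Thm. 1.1] -/
theorem hodgeConjectureFor_square_of_sqrtThreeSector_of_embedding (hB : Buskin2019_hodgeIsometry_algebraic)
    (hQ3 : Varesco2023_quotientSimilitude_three_of_transcendental_embedding) (hS : IsK3Surface S)
    (η : complexBetti S (2 * 1) ≃ₗ[ℂ] (K3Index → ℂ)) (p : complexBetti S (2 * 2)) (x : K3Index → ℂ)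
    (hM : MarkedK3[S, η, p, x])
    (ι : (K3Index → ℚ) →ₗ[ℚ] (Fin 10 → ℚ))
    (hiso : ∀ v w : K3Index → ℚ, IsTranscendentalCoord S η v → IsTranscendentalCoord S η w →
      ∑ i : Fin 10, (![1, 1, 1, -1, -1, -1, -2, -6, -2, -6] : Fin 10 → ℚ) i * ι v i * ι w i =
        k3FormRat v w)
    (hinj : ∀ v : K3Index → ℚ, IsTranscendentalCoord S η v → ι v = 0 → v = 0)
    (ψ : complexBetti S (2 * 1) →ₗ[ℂ] complexBetti S (2 * 1)) (hψ : SqrtSector[S, ψ, 3]) :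
    HodgeConjectureFor 4 (S ⊗ S) := by
  obtain ⟨hψT, hψrat, hψtyp, hψsq, hψmul, -⟩ := id hψ
  obtain ⟨γ, hγalg, hγ⟩ := sqrtThree_cycleInduced_of_embedding hB hQ3 hS η p x hM ι hiso hinj ψ hψT hψrat
    hψtyp (fun y hy ↦ by simpa using hψsq y hy) (fun y hy z hz ↦ by simpa using hψmul y hy z hz)
  exact hodgeConjectureFor_square_of_corr_of_sector hS ψ hψ hγalg hγ

end Summit.HodgeConjecture.HodgeConjecture.Theorems.MarkmanPartnerTransport.QuotientSimilitude

end
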